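import Summits.BirchSwinnertonDyer.Rank1Residual.GaloisImage.KolyvaginPropagatedCount
import Summits.BirchSwinnertonDyer.Rank1Residual.GaloisImage.KolyvaginLevelCounting
import Summits.BirchSwinnertonDyer.Rank1Residual.GaloisImage.KolyvaginPrimeLocalShapeRatHolds
import HarnessLib

/-!
# The Poitou–Tate COUNT for the propagated structure at every Kolyvagin LEVEL:
# `#H¹_{𝓕_can(d)}(ℚ, E[p^{k+1}]) = p^{k+1} · #H¹_{𝓕_can(d)^*}(ℚ, E[p^{k+1}]^D)`
# (cell `b2b-bsdres`, team n1011, ROUTE-1 item R1-23 (a′), skeleton `cells/n1011/skel/T-R1-23.md` §3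
# input "pair count at transverse levels" = the binders `hPT`, `hPT'` of n1011-p11's scalar transport
# `Transport.pow_dvd_iff_of_comp`; seat p18)

HONEST FRAMING (verbatim for the cell): this is a research route on the CONSTRUCTION-SHAPED class
`X4` (`N11`, additive `3`, `surj(3)`); prove what is provable now; no claim beyond stated classes;
nothing booked; no mark / label moved.  TOOL theorems only — no definition, no named fact.

## What is proved

* `DeepLedger.natCard_selmerGroup_propagated_atLevel_eq` — for every level `d` of a Kolyvagin datum
  `D` on `E[p^{k+1}]` whose primes lie off the admissible set `T` and have the local shape
  `#H¹_ur(ℚ_𝔮, E[p^{k+1}]) = #𝒯_𝔮` (Rubin Ex. 1.9.7, a BINDER `hUT`):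
  `#H¹_{𝓕_can(d)} = p^{k+1} · #H¹_{𝓕_can(d)^*}`.  Proof: the empty-level count
  (`natCard_selmerGroup_propagated_eq`, this seat) and the level-independence of `λ(d) − λ^*(d)`
  (`CoreRankZero.card_selmerGroup_atLevel_mul`, n1011-p11, Rubin Ex. 2.1.4 = Mazur–Rubin Cor. 2.3.6:
  `#H¹_{𝓕(d)} · #H¹_{𝓕^*} = #H¹_𝓕 · #H¹_{𝓕(d)^*}`), cancelling `#H¹_{𝓕_can^*} ≠ 0`.  NO transverse
  orthogonality is used: the dual structure is the annihilator structure `inv.dualSelmerStructure`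
  throughout, exactly as in Sakamoto's Thm. 4.4 (2) instances of the cell (R1-22).
* `natCard_unramifiedSubgroup_eq_natCard_transverse_rat_of_primes_eq` — the binder `hUT` DISCHARGED
  over `ℚ` for data of Sakamoto's shape (`D.primes = frobeniusClassPrimes ρ S τ N`, cyclotomic
  transverse condition, `M/(τ − 1)M ≃ ℤ/N`, `τ ∈ Gal(ℚ̄/ℚ(μ_N))`, `N·M = 0`): both sides equal `N`
  ((U) `natCard_unramifiedSubgroup_toLocal_of_primes_eq`, (T)
  `natCard_transverse_rat_of_primes_eq_of_smul_eq_zero'`).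

References: K. Rubin, PCMI 18 (2011) Ex. 1.9.7, Ex. 2.1.4 [Rubin2011]; B. Mazur, K. Rubin, Mem. AMS
799 (2004) Cor. 2.3.6, Prop. 2.3.5 [MazurRubin2004]; R. Sakamoto, Math. Ann. (2024) Def. 3.9,
Thm. 4.4 [Sakamoto2024].
-/

noncomputable section

open scoped Classical NumberField
open Function Field NumberField IsDedekindDomain WeierstrassCurve
  Literature.NumberTheory.EllipticCurves
  Literature.NumberTheory.GaloisRepresentations
  Literature.NumberTheory.GaloisRepresentations.DiscreteGaloisModule Literature.NumberTheory.GaloisCohomology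

namespace Summit.BirchSwinnertonDyer.Rank1Residual.GaloisImage

namespace DeepLedger

variable (W : WeierstrassCurve ℚ) [W.IsElliptic] (p : ℕ) [hp : Fact p.Prime] (k : ℕ)

/-- **The Poitou–Tate count at every level: `#H¹_{𝓕_can(d)}(ℚ, E[p^{k+1}]) =
p^{k+1} · #H¹_{𝓕_can(d)^*}(ℚ, E[p^{k+1}]^D)`** (`p` odd) for every level `d` of a Kolyvagin datum
`D` on `E[p^{k+1}]` with primes off `T` and `#H¹_ur(ℚ_𝔮, E[p^{k+1}]) = #𝒯_𝔮` at its primes.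
Binders as in `natCard_selmerGroup_propagated_eq` (the Poitou–Tate family at the modulus `p^{k+1}`
with its four properties and injective local invariant maps, `hEP`, the `Λ`-clauses at `v_p`, an
admissible `T ∋ v_p`, `Sel_{p^{k+1}}(E/ℚ)` finite) plus `hPS`, `hUT`.
[cite: Rubin2011, Exercise 2.1.4 (p. 18)] [cite: MazurRubin2004, Cor. 2.3.6 and Prop. 2.3.5] -/
theorem natCard_selmerGroup_propagated_atLevel_eq (hp2 : p ≠ 2) {v₀ : HeightOneSpectrum (𝓞 ℚ)}
    (hv₀ : ((p : ℕ) : 𝓞 ℚ) ∈ v₀.asIdeal)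
    [Finite (geomTorsion W ((p : ℤ) ^ k * (p : ℤ)))]
    (Λ : galoisCohomology ((W.torsionGaloisModule ((p : ℤ) ^ k * (p : ℤ))).toLocal (Sum.inr v₀)) 1
      →+ ZMod (p ^ (k + 1)))
    (hon : ∀ r : ZMod (p ^ (k + 1)), ∃ x ∈ propagatedSelmerStructure W p k (Sum.inr v₀), Λ x = r)
    (hker : ∀ x ∈ propagatedSelmerStructure W p k (Sum.inr v₀),
      Λ x = 0 ↔ x ∈ W.kummerSelmerStructure ((p : ℤ) ^ k * (p : ℤ)) (Sum.inr v₀))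
    (inv : LocalInvariants ℚ (p ^ (k + 1))) (hperf : inv.IsPerfect) (hsum : inv.SumLocalTermEqZero)
    (hcompl : inv.SelmerComplement)
    (hinj : ∀ v : HeightOneSpectrum (𝓞 ℚ), Injective (inv (Sum.inr v)))
    (hEP : ∀ v : HeightOneSpectrum (𝓞 ℚ), localEulerPoincareCharacteristic (v.adicCompletion ℚ))
    (T : Finset (HeightOneSpectrum (𝓞 ℚ))) (hv₀T : v₀ ∈ T)
    (hT : ∀ v : HeightOneSpectrum (𝓞 ℚ), v ∉ T →
      (((p ^ (k + 1) : ℕ) : ℕ) : 𝓞 ℚ) ∉ v.asIdeal ∧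
        GaloisRep.IsUnramifiedAt v (W.torsionGaloisModule ((p : ℤ) ^ k * (p : ℤ))))
    (h𝓕T : (propagatedSelmerStructure W p k).IsUnramifiedOutside (finSupport T))
    (h𝓚T : (W.kummerSelmerStructure ((p : ℤ) ^ k * (p : ℤ))).IsUnramifiedOutside (finSupport T))
    [Finite (W.kummerSelmerStructure ((p : ℤ) ^ k * (p : ℤ))).selmerGroup]
    (D : KolyvaginDatum (W.torsionGaloisModule ((p : ℤ) ^ k * (p : ℤ))))
    (hPS : ∀ q ∈ D.primes, q ∉ T)
    (hUT : ∀ q ∈ D.primes,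
      Nat.card (unramifiedSubgroup (GaloisRep.toLocal q (W.torsionGaloisModule ((p : ℤ) ^ k * (p : ℤ)))) 1) =
        Nat.card (D.transverse (Sum.inr q)))
    {d : Finset (HeightOneSpectrum (𝓞 ℚ))} (hd : D.IsLevel d) :
    Nat.card (D.atLevel (propagatedSelmerStructure W p k) d).selmerGroup =
      p ^ (k + 1) * Nat.card (inv.dualSelmerStructure (W.torsionGaloisModule ((p : ℤ) ^ k * (p : ℤ)))
        (D.atLevel (propagatedSelmerStructure W p k) d)).selmerGroup := by
  haveI : NeZero (p ^ (k + 1)) := ⟨pow_ne_zero _ hp.out.ne_zero⟩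
  -- the empty-level count
  have h0 := natCard_selmerGroup_propagated_eq W p k hp2 hv₀ Λ hon hker inv hperf hsum hcompl hinj
    hEP T hv₀T hT h𝓕T h𝓚T
  -- `E[p^{k+1}]` is killed by `p^{k+1}`
  have hM : ∀ m : geomTorsion W ((p : ℤ) ^ k * (p : ℤ)), (p ^ (k + 1)) • m = 0 := fun m => by
    have h := W.natAbs_nsmul_geomTorsion m
    rwa [show ((p : ℤ) ^ k * (p : ℤ)).natAbs = p ^ (k + 1) by
      rw [Int.natAbs_mul, Int.natAbs_pow, Int.natAbs_natCast, pow_succ]] at h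
  -- `H¹_{𝓕_can}` is finite: `𝓕_can = 𝓚` off `v₀`
  have hfin : Finite (propagatedSelmerStructure W p k).selmerGroup := by
    refine CoreRankZero.finite_selmerGroup_of_le_off {v₀}
      (𝓛 := W.kummerSelmerStructure ((p : ℤ) ^ k * (p : ℤ))) (fun v hv => le_of_eq ?_) inferInstance
    rcases v with w | v
    · exact apply_inl_eq_of_odd W p k hp2 _ _ w
    · have hne : v ≠ v₀ := fun h => hv v₀ (Finset.mem_singleton_self v₀) (by rw [h])
      have hpv : ((p : ℕ) : 𝓞 ℚ) ∉ v.asIdeal := fun h' =>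
        hne (heightOneSpectrum_eq_of_natCast_mem hp.out h' hv₀)
      exact propagatedSelmerStructure_inr_eq_kummerSelmerStructure W p k hpv
  have hne : Nat.card (propagatedSelmerStructure W p k).selmerGroup ≠ 0 := Nat.card_pos.ne'
  -- so its dual Selmer group is finite too
  have hN0 : Nat.card (inv.dualSelmerStructure (W.torsionGaloisModule ((p : ℤ) ^ k * (p : ℤ)))
      (propagatedSelmerStructure W p k)).selmerGroup ≠ 0 := by
    intro h
    rw [h, mul_zero] at h0
    exact hne h0
  have hfind : Finite (inv.dualSelmerStructure (W.torsionGaloisModule ((p : ℤ) ^ k * (p : ℤ)))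
      (propagatedSelmerStructure W p k)).selmerGroup := Nat.finite_of_card_ne_zero hN0
  -- admissibility off `S(T)`
  have hS : ∀ v : HeightOneSpectrum (𝓞 ℚ), (Sum.inr v : Place ℚ) ∉ finSupport T →
      (((p ^ (k + 1) : ℕ) : ℕ) : 𝓞 ℚ) ∉ v.asIdeal ∧
        GaloisRep.IsUnramifiedAt v (W.torsionGaloisModule ((p : ℤ) ^ k * (p : ℤ))) := fun v hv =>
    hT v fun h => hv ((inr_mem_finSupport_iff T v).2 h)
  have hPS' : ∀ q ∈ D.primes, (Sum.inr q : Place ℚ) ∉ finSupport T := fun q hq h =>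
    hPS q hq ((inr_mem_finSupport_iff T q).1 h)
  -- `λ(d) − λ^*(d)` is constant along the levels (p11, Rubin Ex. 2.1.4)
  have hmul := CoreRankZero.card_selmerGroup_atLevel_mul hperf hsum hcompl hM hS h𝓕T hfin hfind
    hPS' hUT hd
  rw [h0] at hmul
  -- cancel `#H¹_{𝓕_can^*} ≠ 0`
  refine mul_right_cancel₀ hN0 ?_
  rw [hmul]
  ring

end DeepLedger

/-- **The local binder `hUT` over `ℚ` for data of Sakamoto's shape**: for a finite discrete
`Γ_ℚ`-module `M` killed by `N`, a Kolyvagin datum with `D.primes = frobeniusClassPrimes ρ S τ N` and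
the cyclotomic transverse condition, `M/(τ − 1)M ≃ ℤ/N` and `τ ∈ Gal(ℚ̄/ℚ(μ_N))`:
`#H¹_ur(ℚ_𝔮, M) = #𝒯_𝔮` (both equal `N`) at every prime of the datum (Rubin Ex. 1.9.7 / Prop.
1.9.5 (1) and Prop. 1.4.13 (1)). [cite: Rubin2011, Prop. 1.9.5 (1) (p. 16) and Prop. 1.4.13 (1) (p. 9)] -/
theorem natCard_unramifiedSubgroup_eq_natCard_transverse_rat_of_primes_eq
    {M : Type} [AddCommGroup M] [TopologicalSpace M] [DiscreteTopology M] [Finite M]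
    (ρ : DiscreteGaloisModule ℚ M) {D : KolyvaginDatum ρ}
    {S : Set (HeightOneSpectrum (𝓞 ℚ))} {τ : absoluteGaloisGroup ℚ} {N : ℕ} [NeZero N]
    (hP : D.primes = frobeniusClassPrimes ρ S τ N) (hT : D.transverse = cyclotomicTransverse ρ)
    (hτ : Nonempty (cokerSubOne ρ τ ≃+ ZMod N)) (hτμ : τ ∈ rootsOfUnityFixer ℚ N)
    (hMN : ∀ m : M, N • m = 0) :
    ∀ q ∈ D.primes, Nat.card (unramifiedSubgroup (GaloisRep.toLocal q ρ) 1) =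
      Nat.card (D.transverse (Sum.inr q)) := fun q hq => by
  rw [natCard_unramifiedSubgroup_toLocal_of_primes_eq ρ hP hτ q hq,
    natCard_transverse_rat_of_primes_eq_of_smul_eq_zero' ρ hP hT hτ hτμ hMN q hq]

end Summit.BirchSwinnertonDyer.Rank1Residual.GaloisImage

end
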